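import Summits.BirchSwinnertonDyer.BirchSwinnertonDyer.Theorems.ErratumRoadFiveRegCertKernelFiveLog
import HarnessLib

/-!
# Route `ErratumRoadFive` (rung K2, `p ≥ 5`): the REG5CERT KERNEL EVALUATOR, part 3 — FIRST-ORDER values of the
# Iwasawa logarithm in `ℚ₅` and the Tate parameter from `j(q) = j(E)` (the extra term `log_p(u)²/log_p(q_E)` of the
# Stein–Wuthrich §4.2 height at a SPLIT multiplicative prime)
# (cell `bsd-stepL`, seat `bsd-stepL-reg3-eng` g5; `--supports stmt-BirchSwinnertonDyer-19702`)

HONEST FRAMING: BSD is not proved by any of this; nothing here closes a crux; Schneider's non-degeneracy conjecture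
(barrier `Literature.Barriers.BirchSwinnertonDyer.PAdicHeightNondegeneracy`) is asserted NOWHERE. Parts 1–2
(`…RegCertKernelFiveSeries`, `…RegCertKernelFiveLog`) sufficed at a NON-split prime, where the height is a DIFFERENCE of
two logarithms and only `≠ 0` is needed. At a SPLIT prime the modified height `heightSplitCoord = heightFourOneCoord −
log_Ê(z)²/(C²·log₅ q_E)` (SW 2013 §4.2, p. 16) needs the VALUE of each logarithm to first order and THE Tate parameter
`q_E` to a few digits. Theorems only (0 defs, 0 facts), generic in `ℚ₅`:

* §5 `norm_padicLog_sub_unitPart_le` — `‖log₅ x − 4⁻¹(u⁴ − 1)‖ ≤ ‖1 − u⁴‖²` for `x ≠ 0`, `u = x·5^{−ord x}` its unit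
  part (`log₅ x = 4⁻¹L(u⁴)` and `‖L(y) + (1 − y)‖ ≤ ‖1 − y‖²`, tree `norm_padicLogSeries_add_le`); the unit case
  `norm_padicLog_unit_sub_le`;
* §6 `norm_tateParam_of_tateJ_eq` — from `‖q‖ < 1` and `j(q) = j₀`: `‖q‖ = ‖j₀‖⁻¹` and `‖q − j₀⁻¹‖ ≤ ‖q‖²`
  (ATAEC V.5.1 in the tree's form `norm_inv_tateJ_sub_le`, `norm_tateJ_eq`).

References: [Iwasawa1972PadicL] §4.4; [SilvermanATAEC1994] V.3.1, Lemma V.5.1; [SteinWuthrich2013] §4.2 (p. 16).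
-/

open scoped Classical

open WeierstrassCurve Literature.NumberTheory.EllipticCurves
  Literature.NumberTheory.EllipticCurves.SteinWuthrich2013

namespace Summit.BirchSwinnertonDyer.Rank1Residual.X11b.RegMult.KernelCertFive

variable [Fact (Nat.Prime 5)]

/-! ### §5 The Iwasawa logarithm to first order -/

/-- `‖(4 : ℚ₅)⁻¹‖ = 1`. [folklore] -/
private theorem norm_inv_four₅ : ‖(4 : ℚ_[5])⁻¹‖ = 1 := by
  rw [norm_inv, show (4 : ℚ_[5]) = ((4 : ℤ) : ℚ_[5]) by norm_cast, norm_intCast_eq_one_of_not_dvd (by decide),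
    inv_one]

/-- **`log₅ x = 4⁻¹(u⁴ − 1) + O(‖1 − u⁴‖²)`** for `x ≠ 0` with unit part `u = x·5^{−ord₅ x}`: by definition
`log₅ x = 4⁻¹·L(u⁴)` (Iwasawa normalisation), `u⁴` is a principal unit (Fermat), and the series satisfies
`‖L(y) + (1 − y)‖ ≤ ‖1 − y‖²` (`norm_padicLogSeries_add_le`, `‖2⁻¹‖₅ = 1`). [cite: Iwasawa1972PadicL, §4.4] -/
theorem norm_padicLog_sub_unitPart_le {x : ℚ_[5]} (hx : x ≠ 0) :
    ‖padicLog 5 x - (4 : ℚ_[5])⁻¹ * ((x * ((5 : ℕ) : ℚ_[5]) ^ (-x.valuation)) ^ 4 - 1)‖ ≤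
      ‖1 - (x * ((5 : ℕ) : ℚ_[5]) ^ (-x.valuation)) ^ 4‖ ^ 2 := by
  set u : ℚ_[5] := x * ((5 : ℕ) : ℚ_[5]) ^ (-x.valuation) with hu
  have hun : ‖u‖ = 1 := norm_mul_zpow_neg_valuation hx
  have h1 : ‖1 - u ^ 4‖ < 1 := by
    have := norm_one_sub_pow_sub_one_lt (p := 5) hun
    rwa [show (5 : ℕ) - 1 = 4 from rfl] at this
  have hlog : padicLog 5 x = (4 : ℚ_[5])⁻¹ * padicLogSeries 5 (u ^ 4) := by
    rw [padicLog_of_ne_zero hx, show (5 : ℕ) - 1 = 4 from rfl]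
    have h4 : ((5 : ℕ) : ℚ_[5]) - 1 = 4 := by norm_num
    rw [h4]
  have hest := norm_padicLogSeries_add_le (p := 5) h1
  rw [norm_inv_two₅, mul_one] at hest
  have hid : padicLog 5 x - (4 : ℚ_[5])⁻¹ * (u ^ 4 - 1) =
      (4 : ℚ_[5])⁻¹ * (padicLogSeries 5 (u ^ 4) + (1 - u ^ 4)) := by rw [hlog]; ring
  rw [hid, norm_mul, norm_inv_four₅, one_mul]
  exact hest

/-- **The unit case**: for `‖U‖₅ = 1`, `‖log₅ U − 4⁻¹(U⁴ − 1)‖ ≤ ‖1 − U⁴‖²`. [cite: Iwasawa1972PadicL, §4.4] -/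
theorem norm_padicLog_unit_sub_le {U : ℚ_[5]} (hU : ‖U‖ = 1) :
    ‖padicLog 5 U - (4 : ℚ_[5])⁻¹ * (U ^ 4 - 1)‖ ≤ ‖1 - U ^ 4‖ ^ 2 := by
  have hU0 : U ≠ 0 := by intro h; rw [h, norm_zero] at hU; exact zero_ne_one hU
  have hval : U.valuation = 0 := valuation_eq_of_norm_eq hU0 (n := 0) (by rw [hU]; simp)
  have h := norm_padicLog_sub_unitPart_le hU0
  rwa [hval, neg_zero, zpow_zero, mul_one] at h

/-- **The logarithm of a quotient**: `log₅ A − log₅ B = −log₅ (B/A)` for `A, B ≠ 0` (multiplicativity,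
`padicLog_mul_holds`). [cite: Iwasawa1972PadicL, §4.4] -/
theorem padicLog_sub_eq_neg_padicLog_div {A B : ℚ_[5]} (hA : A ≠ 0) (hB : B ≠ 0) :
    padicLog 5 A - padicLog 5 B = -padicLog 5 (B / A) := by
  have h := padicLog_mul_holds 5 (div_ne_zero hB hA) hA
  rw [div_mul_cancel₀ B hA] at h
  linear_combination -h

/-! ### §6 THE Tate parameter from `j(q) = j₀` -/

/-- **ATAEC V.5.1 in use**: for `‖q‖₅ < 1` with `j(q) = j₀` one has `‖q‖ = ‖j₀‖⁻¹` (`norm_tateJ_eq`) and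
`‖q − j₀⁻¹‖ ≤ ‖q‖²` (`norm_inv_tateJ_sub_le`): the Tate parameter is `1/j(E)` to twice its own precision.
[cite: SilvermanATAEC1994, Lemma V.5.1] -/
theorem norm_tateParam_of_tateJ_eq {q j₀ : ℚ_[5]} (hq1 : ‖q‖ < 1) (hj : tateJ q = j₀) :
    ‖q‖ = ‖j₀‖⁻¹ ∧ ‖q - j₀⁻¹‖ ≤ ‖q‖ * ‖q‖ := by
  refine ⟨?_, ?_⟩
  · have h := norm_tateJ_eq hq1
    rw [hj] at h
    rw [h, inv_inv]
  · have h := norm_inv_tateJ_sub_le hq1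
    rw [hj] at h
    rwa [norm_sub_rev]

end Summit.BirchSwinnertonDyer.Rank1Residual.X11b.RegMult.KernelCertFive
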